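import Summits.HubbardSuperconductivity.HubbardSuperconductivity.Theses.AposterioriCapRg
import Literature.MathematicalPhysics.QuantumLattice.DWaveOrderParameterProofs

/-!
# drefute (line `cauchy-griffiths-source-shells`): what clause (b) of the lead's stub P forces

The stairs bookkeeping is TWO-SIDED.  From the dyadic second-difference bound that clause (b) (through the true
`stub_shellCurvatureBudget`) is designed to produce — `D_{L+1}(h) ≤ 2Φ(h)(L+1)²` eventually in `L` at every
stair `h ∈ (0,h₀]`, with `Σ_{j≤J} Φ(h₀/2^j) ≤ B` — the chord inequalities of the tree give, kernel-checked below,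

  `liminf_L dWaveSourceDensity (L+1) U μ h₀ ≤ dWaveOrderParameter U μ + B`      (`top_le_orderParameter_add`)

i.e. with the lead's `B = fst/4`: **the sourced density at R's own top field `h₀` may exceed the SPONTANEOUS
order parameter by at most a quarter of the certified floor**.  R's `h₀` is universally quantified and its
hypothesis (certification on `Ioc 0 h₀`) does not bound `h₀` against the datum; in the route's own honest scenario
the sourced density rises from `≈ m₀` at `h → 0⁺` to `≈ 2m₀` already at `h₀` of the order of the amplitude scale
`m₀/χ_pair ≈ Δ₀`, so (b) as typed fails for every admissible instance with such an `h₀` (see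
stubs/StubSourceAnalyticShells.md).  The planner's checked skeleton had `∃ h₁ ∈ Ioc 0 h₀` here; the lead's
re-typing pinned the top stair at R's `h₀`.
-/

open Filter Set
open Literature.MathematicalPhysics.QuantumLattice

namespace DrefuteOverStrength

/-- The dyadic second difference of the sourced vacuum energy at size `L+1` (the quantity bounded in the
lead's `stub_slopeTransfer`, hypothesis 4, and produced by clause (b) + `stub_shellCurvatureBudget`). -/
noncomputable def secondDiff (U μ h : ℝ) (L : ℕ) : ℝ :=
  ((dWaveSourceTorus (L + 1) U μ h).groundEnergy - (dWaveSourceTorus (L + 1) U μ (2 * h)).groundEnergy) / h -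
    ((dWaveSourceTorus (L + 1) U μ (h / 2)).groundEnergy - (dWaveSourceTorus (L + 1) U μ h).groundEnergy) / (h / 2)

/-- The forward chord `A_L(h) = (E(h) - E(2h))/h` at size `L+1`. -/
noncomputable def chord (U μ h : ℝ) (L : ℕ) : ℝ :=
  ((dWaveSourceTorus (L + 1) U μ h).groundEnergy - (dWaveSourceTorus (L + 1) U μ (2 * h)).groundEnergy) / h

theorem secondDiff_eq (U μ h : ℝ) (L : ℕ) :
    secondDiff U μ h L = chord U μ h L - chord U μ (h / 2) L := by
  simp only [secondDiff, chord]
  congr 2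
  ring_nf

/-- Lower chord: `2(L+1)² m(h) ≤ A_L(h)` for `h > 0` (tree: `dWaveSourceDensity_mul_le_groundEnergy_drop`). -/
theorem density_le_chord (U μ : ℝ) {h : ℝ} (hh : 0 < h) (L : ℕ) :
    2 * ((L + 1 : ℕ) : ℝ) ^ 2 * dWaveSourceDensity (L + 1) U μ h ≤ chord U μ h L := by
  have key := dWaveSourceDensity_mul_le_groundEnergy_drop (L := L + 1) U μ h (2 * h)
  rw [chord, le_div_iff₀ hh]
  nlinarith [key]

/-- Upper chord: `A_L(h/2)·… ≤ 2(L+1)² m(h)`, i.e. `(E(h/2) - E(h))/(h/2) ≤ 2(L+1)² m(h)` for `h > 0`. -/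
theorem chord_half_le_density (U μ : ℝ) {h : ℝ} (hh : 0 < h) (L : ℕ) :
    chord U μ (h / 2) L ≤ 2 * ((L + 1 : ℕ) : ℝ) ^ 2 * dWaveSourceDensity (L + 1) U μ h := by
  have key := dWaveSourceDensity_mul_le_groundEnergy_drop (L := L + 1) U μ h (h / 2)
  have h2 : 2 * (h / 2) = h := by ring
  rw [chord, h2, div_le_iff₀ (by positivity)]
  nlinarith [key]

/-- **Telescoping**: eventually in `L`, the rise of the sourced density over the dyadic ladder below `h₀` is at
most the budget: `m_{L+1}(h₀) - m_{L+1}(h₀/2^J) ≤ B`. -/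
theorem rise_le_budget (U μ : ℝ) {h₀ B : ℝ} (Φ : ℝ → ℝ) (hh₀ : 0 < h₀)
    (hsum : ∀ J : ℕ, ∑ j ∈ Finset.range (J + 1), Φ (h₀ / 2 ^ j) ≤ B)
    (h2 : ∀ h ∈ Set.Ioc (0:ℝ) h₀, ∀ᶠ L : ℕ in atTop, secondDiff U μ h L ≤ 2 * Φ h * ((L + 1 : ℕ) : ℝ) ^ 2)
    (J : ℕ) :
    ∀ᶠ L : ℕ in atTop,
      dWaveSourceDensity (L + 1) U μ h₀ - dWaveSourceDensity (L + 1) U μ (h₀ / 2 ^ J) ≤ B := by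
  have hstair : ∀ j : ℕ, h₀ / 2 ^ j ∈ Set.Ioc (0:ℝ) h₀ := fun j =>
    ⟨by positivity, div_le_self hh₀.le (one_le_pow₀ (by norm_num))⟩
  have hall : ∀ᶠ L : ℕ in atTop, ∀ j ∈ Finset.range (J + 1),
      secondDiff U μ (h₀ / 2 ^ j) L ≤ 2 * Φ (h₀ / 2 ^ j) * ((L + 1 : ℕ) : ℝ) ^ 2 :=
    (Filter.eventually_all_finset _).2 fun j _ => h2 _ (hstair j)
  filter_upwards [hall] with L hL
  have hL2 : (0 : ℝ) < ((L + 1 : ℕ) : ℝ) ^ 2 := by positivity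
  -- telescope the chords
  have htel : ∑ j ∈ Finset.range (J + 1), secondDiff U μ (h₀ / 2 ^ j) L =
      chord U μ h₀ L - chord U μ (h₀ / 2 ^ (J + 1)) L := by
    have hshift : ∀ j : ℕ, h₀ / 2 ^ j / 2 = h₀ / 2 ^ (j + 1) := fun j => by rw [pow_succ]; ring
    simp only [secondDiff_eq, hshift]
    rw [Finset.sum_range_sub' (fun j => chord U μ (h₀ / 2 ^ j) L) (J + 1)]
    simp
  have hsumD : ∑ j ∈ Finset.range (J + 1), secondDiff U μ (h₀ / 2 ^ j) L ≤
      2 * ((L + 1 : ℕ) : ℝ) ^ 2 * B := by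
    calc ∑ j ∈ Finset.range (J + 1), secondDiff U μ (h₀ / 2 ^ j) L
        ≤ ∑ j ∈ Finset.range (J + 1), 2 * Φ (h₀ / 2 ^ j) * ((L + 1 : ℕ) : ℝ) ^ 2 := Finset.sum_le_sum hL
      _ = 2 * ((L + 1 : ℕ) : ℝ) ^ 2 * ∑ j ∈ Finset.range (J + 1), Φ (h₀ / 2 ^ j) := by
          rw [Finset.mul_sum]; refine Finset.sum_congr rfl fun j _ => by ring
      _ ≤ 2 * ((L + 1 : ℕ) : ℝ) ^ 2 * B := by
          exact mul_le_mul_of_nonneg_left (hsum J) (by positivity)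
  have hlow := density_le_chord U μ hh₀ L
  have hup : chord U μ (h₀ / 2 ^ (J + 1)) L ≤
      2 * ((L + 1 : ℕ) : ℝ) ^ 2 * dWaveSourceDensity (L + 1) U μ (h₀ / 2 ^ J) := by
    have := chord_half_le_density U μ (hstair J).1 L
    have hshift : h₀ / 2 ^ J / 2 = h₀ / 2 ^ (J + 1) := by rw [pow_succ]; ring
    rwa [hshift] at this
  rw [htel] at hsumD
  nlinarith [hlow, hup, hsumD, hL2]

/-- **What clause (b) forces**: the sourced density at the TOP field `h₀` exceeds the spontaneous order
parameter by at most the budget `B` (`= fst/4` in the lead's stub P). -/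
theorem top_le_orderParameter_add (U μ : ℝ) {h₀ B : ℝ} (Φ : ℝ → ℝ) (hh₀ : 0 < h₀)
    (hsum : ∀ J : ℕ, ∑ j ∈ Finset.range (J + 1), Φ (h₀ / 2 ^ j) ≤ B)
    (h2 : ∀ h ∈ Set.Ioc (0:ℝ) h₀, ∀ᶠ L : ℕ in atTop, secondDiff U μ h L ≤ 2 * Φ h * ((L + 1 : ℕ) : ℝ) ^ 2) :
    liminf (fun L : ℕ => dWaveSourceDensity (L + 1) U μ h₀) atTop ≤ dWaveOrderParameter U μ + B := by
  -- floor at every stair of the ladder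
  have hJ : ∀ J : ℕ, liminf (fun L : ℕ => dWaveSourceDensity (L + 1) U μ h₀) atTop - B ≤
      liminf (fun L : ℕ => dWaveSourceDensity (L + 1) U μ (h₀ / 2 ^ J)) atTop := by
    intro J
    have hev := rise_le_budget U μ Φ hh₀ hsum h2 J
    have hpos : (0:ℝ) < h₀ / 2 ^ J := by positivity
    rw [sub_le_iff_le_add]
    calc liminf (fun L : ℕ => dWaveSourceDensity (L + 1) U μ h₀) atTop
        ≤ liminf (fun L : ℕ => dWaveSourceDensity (L + 1) U μ (h₀ / 2 ^ J) + B) atTop := by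
          refine liminf_le_liminf ?_ ?_ ?_
          · filter_upwards [hev] with L hL
            linarith
          · exact isBoundedUnder_of_eventually_ge (a := 0)
              (Eventually.of_forall fun L => dWaveSourceDensity_nonneg U μ hh₀.le)
          · exact isCoboundedUnder_ge_of_eventually_le atTop
              (x := 2 * ∑ e ∈ insert (0 : Literature.Probability.LatticeModels.Site 2)
                Literature.MathematicalPhysics.QuantumLattice.unitSteps, |dWaveFormFactor e / Real.sqrt 2| + B)
              (Eventually.of_forall fun L => by
                have := dWaveSourceDensity_le_const (L + 1) U μ (h₀ / 2 ^ J)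
                linarith)
      _ = liminf (fun L : ℕ => dWaveSourceDensity (L + 1) U μ (h₀ / 2 ^ J)) atTop + B := by
          rw [liminf_add_const]
          · exact isCoboundedUnder_ge_of_eventually_le atTop
              (x := 2 * ∑ e ∈ insert (0 : Literature.Probability.LatticeModels.Site 2)
                Literature.MathematicalPhysics.QuantumLattice.unitSteps, |dWaveFormFactor e / Real.sqrt 2|)
              (Eventually.of_forall fun L => dWaveSourceDensity_le_const (L + 1) U μ (h₀ / 2 ^ J))
          · exact isBoundedUnder_of_eventually_ge (a := 0)
              (Eventually.of_forall fun L => dWaveSourceDensity_nonneg U μ hpos.le)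
  -- the ladder reaches below every positive field
  have key : liminf (fun L : ℕ => dWaveSourceDensity (L + 1) U μ h₀) atTop - B ≤ dWaveOrderParameter U μ := by
    refine le_dWaveOrderParameter_of_forall U μ hh₀ fun h hh => ?_
    obtain ⟨J, hJ'⟩ := pow_unbounded_of_one_lt (h₀ / h) (one_lt_two : (1:ℝ) < 2)
    have hle : h₀ / 2 ^ J ≤ h := by
      rw [div_le_iff₀ (by positivity)]
      rw [div_lt_iff₀ hh.1] at hJ'
      linarith
    exact (hJ J).trans (liminf_dWaveSourceDensity_mono U μ (by positivity) hle)
  linarith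

end DrefuteOverStrength

namespace DrefuteOverStrength

/-- **Candidate proof of the lead's `stub_slopeTransfer` (M3), exact signature** — a 3-line corollary of
`top_le_orderParameter_add` with `B = Φtot`. (Positive lemma: evidence for the prover, not landed by the refuter.) -/
theorem stub_slopeTransfer_proof : ∀ (U μ h₀ m₁ Φtot : ℝ) (Φ : ℝ → ℝ), 0 < h₀ →
    (∀ J : ℕ, ∑ j ∈ Finset.range (J + 1), Φ (h₀ / 2 ^ j) ≤ Φtot) →
    m₁ ≤ liminf (fun L : ℕ => dWaveSourceDensity (L + 1) U μ h₀) atTop →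
    (∀ h ∈ Set.Ioc (0:ℝ) h₀, ∀ᶠ L : ℕ in atTop,
      ((dWaveSourceTorus (L + 1) U μ h).groundEnergy - (dWaveSourceTorus (L + 1) U μ (2 * h)).groundEnergy) / h -
        ((dWaveSourceTorus (L + 1) U μ (h / 2)).groundEnergy - (dWaveSourceTorus (L + 1) U μ h).groundEnergy) / (h / 2) ≤
        2 * Φ h * ((L + 1 : ℕ) : ℝ) ^ 2) →
    m₁ - Φtot ≤ dWaveOrderParameter U μ := by
  intro U μ h₀ m₁ Φtot Φ hh₀ hsum h1 h2
  have key := top_le_orderParameter_add U μ Φ hh₀ hsum (fun h hh => h2 h hh)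
  linarith

end DrefuteOverStrength
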